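import Literature.MathematicalPhysics.QuantumLattice.FermiRG.BGM2006Sec2Setup
import Literature.MathematicalPhysics.QuantumLattice.FermiRG.BGM2003Sectors
import Literature.MathematicalPhysics.QuantumLattice.HubbardFermiRadiusBand
import HarnessLib

/-!
# BGM 2006 §2.4–§2.5 ↔ BGM 2003 App. 7.1: ONE polar frame — dedup bridges between the wave files
# `BGM2006Sec2Setup` (t1) and `BGM2003Sectors` (t3), and the `h = 0` chart identity

Companion of `BGM2006Sec2Setup.lean` (Benfatto–Giuliani–Mastropietro, Ann. Henri Poincaré **7** (2006) 809 =
arXiv:cond-mat/0507686, §2.4–§2.5 [cite: BenfattoGiulianiMastropietro2006, §2.5 (2.47)]) and of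
`BGM2003Sectors.lean` (Ann. Henri Poincaré **4** (2003) 137 = arXiv:cond-mat/0207210, App. 7.1
[cite: BenfattoGiulianiMastropietro2003, §7.1 (A1.6)–(A1.7)]); typer wave gate-hubbard-kl, seat t1.
Both files type the moving frame of a polar curve `ρ = u(θ)` — `τ⃗ = (u'e⃗_r + u e⃗_t)/√(u'² + u²)`,
`n⃗ = (u e⃗_r - u'e⃗_t)/√(u'² + u²)`, curvature `(u² + 2u'² - u u'')/(u'² + u²)^{3/2}` — on two carriers:
t1's one-level radius `u : ℝ → ℝ` (`polarSpeed`, `polarTangent`, `polarNormal`, `polarCurvature`, `dirPerp`;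
used INSIDE the named facts `BGM2006_Lemma_2_1` / `BGM2006_Lemma_2_2`, whose curves are the scale-`h` level
sets `u = levelRadius (ε_h) (μ + e)`), and t3's level family `u : ℝ → ℝ → ℝ` (`BGM2003.speed`,
`unitTangent`, `unitNormal`, `curvature`, `tdir`; the carrier of the hypothesis block `BGM2003.DispersionHyp`
under which Lemmas 7.1–7.4 of BGM 2003 are PROVED in the tree, and which the route file
`KLProgrammeFermiSurfaceBGM2003` instantiates for the free band with the chart `bandFermiRadius (μ + e)`).
The referee's tier-1 audit of `BGM2006Sec2Setup` asked for a bridge so that consumers pick ONE frame family.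
This file PROVES (no definitions, no named facts):

* `dirPerp_eq_tdir` — the two copies of `e⃗_t(θ) = (-sin θ, cos θ)` are the same function (definitionally);
* `polarSpeed_eq_speed`, `polarTangent_eq_unitTangent`, `polarNormal_eq_unitNormal`,
  `polarCurvature_eq_curvature` — at a fixed level `e`, t1's frame of the slice `θ ↦ u θ e` IS t3's frame of
  the family `u` at `(θ, e)`; and, read on t1's native chart `U θ e := levelRadius ε (μ + e) θ` of the curves
  `Σ^{(h)}(e)` of Lemma 2.1: `levelPoint_levelRadius`, `speed_levelRadius`, `unitTangent_levelRadius`,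
  `unitNormal_levelRadius`, `curvature_levelRadius` (so the clauses `c ≤ polarCurvature (levelRadius ε_h (μ+e)) θ`
  of `BGM2006_Lemma_2_1` (1) and `c ≤ curvature U θ e` of `DispersionHyp.convex` are the same inequality);
* `levelRadius_congr`, `levelRadius_add_two_pi`, `levelRadius_add_pi_of_even`,
  `levelRadius_bgmEffDisp_add_pi` — the polar radius `levelRadius ε lev` (Hilbert `ε` of the ray equation)
  depends on `θ` only through the ray: it is `2π`-periodic for EVERY `ε`, and `π`-periodic ("symmetric by
  reflection with respect to the origin", Lemma 2.1 (1)) as soon as `ε` is even — in particular for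
  `ε_h = bgmEffDisp β E h` under (2.36a) `BGMSymmetry E`, with no smallness hypothesis;
* `fermiRadius_eq_bandFermiRadius`, `levelRadius_sqDispersion_eq_bandFermiRadius` — at `E_h ≡ ε`
  (`levelRadius sqDispersion μ = fermiRadius μ`, t1's `levelRadius_sqDispersion`) and on BGM's window
  `-4 < μ < -2-√2` the two tree charts of the free Fermi curve agree: `fermiRadius μ θ = bandFermiRadius μ θ`
  (the `[0, π/2]`-root of `HubbardFermiRadius` is the band root of `HubbardFermiRadiusBand`), so the
  `U = 0` residual of `BGM2006_Lemma_2_1` and the route's `klfs_bgm2003_dispersionHyp` speak of one chart.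

Everything is proved; no `sorry`, no axioms, no instances, no notation.
-/

noncomputable section

open Real

namespace Literature.MathematicalPhysics.QuantumLattice.FermiRG

/-! ### The tangential unit vector -/

/-- `e⃗_t(θ) = (-sin θ, cos θ)`: t1's `dirPerp` ((2.47)) and t3's `tdir` ((A1.6)) are the same function,
definitionally. [cite: BenfattoGiulianiMastropietro2006, §2.5 (2.47) p0010:L53] -/
theorem dirPerp_eq_tdir : dirPerp = tdir := rfl

/-- `e⃗_r(θ + 2π) = e⃗_r(θ)` (cf. the tree's `dir_sub_two_pi_mul`). [folklore] -/
private theorem dir_add_two_pi (θ : ℝ) : dir (θ + 2 * π) = dir θ := by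
  ext i
  fin_cases i <;> simp [dir, Real.cos_add_two_pi, Real.sin_add_two_pi]

/-- `e⃗_r(θ + π) = -e⃗_r(θ)`. [folklore] -/
private theorem dir_add_pi (θ : ℝ) : dir (θ + π) = -dir θ := by
  ext i
  fin_cases i <;> simp [dir, Real.cos_add_pi, Real.sin_add_pi]

/-! ### The frame of a slice `θ ↦ u θ e` of a level family is t3's frame of the family -/

/-- `√(u² + u'²)` ((2.47)) of the slice `θ ↦ u(θ, e)` is `s'(θ, e) = √(u'² + u²)` ((A1.6)).
[cite: BenfattoGiulianiMastropietro2006, §2.5 (2.47) p0010:L53] -/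
theorem polarSpeed_eq_speed (u : ℝ → ℝ → ℝ) (e θ : ℝ) :
    polarSpeed (fun ϑ => u ϑ e) θ = BGM2003.speed u θ e := by
  simp only [polarSpeed, BGM2003.speed, BGM2003.radiusDeriv]
  rw [add_comm]

/-- The unit tangent `τ⃗ = (u'e⃗_r + u e⃗_t)/√(u'² + u²)`: t1's `polarTangent` of the slice ((2.47)) is t3's
`unitTangent` of the family ((A1.6)). [cite: BenfattoGiulianiMastropietro2006, §2.5 (2.47) p0010:L60] -/
theorem polarTangent_eq_unitTangent (u : ℝ → ℝ → ℝ) (e θ : ℝ) :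
    polarTangent (fun ϑ => u ϑ e) θ = BGM2003.unitTangent u θ e := by
  rw [polarTangent, BGM2003.unitTangent, polarSpeed_eq_speed u e θ]
  rfl

/-- The outgoing unit normal `n⃗ = (u e⃗_r - u'e⃗_t)/√(u'² + u²)`: t1's `polarNormal` of the slice ((2.47))
is t3's `unitNormal` of the family ((A1.7)). [cite: BenfattoGiulianiMastropietro2006, §2.5 (2.47) p0010:L62] -/
theorem polarNormal_eq_unitNormal (u : ℝ → ℝ → ℝ) (e θ : ℝ) :
    polarNormal (fun ϑ => u ϑ e) θ = BGM2003.unitNormal u θ e := by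
  rw [polarNormal, BGM2003.unitNormal, polarSpeed_eq_speed u e θ]
  rfl

/-- The curvature `1/r = (u² + 2u'² - u u'')/(u'² + u²)^{3/2}` of the polar curve: t1's `polarCurvature` of
the slice (Lemma 2.1, "`r_h(θ,e)⁻¹ ≥ c`") is t3's `curvature` of the family ((A1.7)).
[cite: BenfattoGiulianiMastropietro2006, §2.4 Lemma 2.1 (2.40) p0009:L39] -/
theorem polarCurvature_eq_curvature (u : ℝ → ℝ → ℝ) (e θ : ℝ) :
    polarCurvature (fun ϑ => u ϑ e) θ = BGM2003.curvature u θ e := by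
  rw [polarCurvature, BGM2003.curvature, polarSpeed_eq_speed u e θ]
  rfl

/-! ### Read on t1's native chart `U θ e := levelRadius ε (μ + e) θ` of the curves `Σ^{(h)}(e)` -/

/-- The point `q⃗(θ, e) = u(θ, e)e⃗_r(θ)` of t3's chart ((A1.1)), for the family `U θ e = levelRadius ε (μ+e) θ`,
is the point `u_h(θ, e)e⃗_r(θ)` of Lemma 2.1 (1) (definitionally). [cite: BenfattoGiulianiMastropietro2006, §2.4 Lemma 2.1 p0009:L44] -/
theorem levelPoint_levelRadius (eps : (Fin 2 → ℝ) → ℝ) (μ θ e : ℝ) :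
    BGM2003.levelPoint (fun ϑ e' => levelRadius eps (μ + e') ϑ) θ e = levelRadius eps (μ + e) θ • dir θ := rfl

/-- `s'(θ, e)` of the family `U θ e = levelRadius ε (μ+e) θ` is `polarSpeed` of the scale-`h` curve `Σ(e)`.
[cite: BenfattoGiulianiMastropietro2006, §2.5 (2.47) p0010:L53] -/
theorem speed_levelRadius (eps : (Fin 2 → ℝ) → ℝ) (μ θ e : ℝ) :
    BGM2003.speed (fun ϑ e' => levelRadius eps (μ + e') ϑ) θ e = polarSpeed (levelRadius eps (μ + e)) θ :=
  (polarSpeed_eq_speed (fun ϑ e' => levelRadius eps (μ + e') ϑ) e θ).symm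

/-- `τ⃗(θ, e)` of the family `U θ e = levelRadius ε (μ+e) θ` is `τ⃗_h` ((2.47)) of the scale-`h` curve `Σ(e)`.
[cite: BenfattoGiulianiMastropietro2006, §2.5 (2.47) p0010:L60] -/
theorem unitTangent_levelRadius (eps : (Fin 2 → ℝ) → ℝ) (μ θ e : ℝ) :
    BGM2003.unitTangent (fun ϑ e' => levelRadius eps (μ + e') ϑ) θ e =
      polarTangent (levelRadius eps (μ + e)) θ :=
  (polarTangent_eq_unitTangent (fun ϑ e' => levelRadius eps (μ + e') ϑ) e θ).symm

/-- `n⃗(θ, e)` of the family `U θ e = levelRadius ε (μ+e) θ` is `n⃗_h` ((2.47)) of the scale-`h` curve `Σ(e)`.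
[cite: BenfattoGiulianiMastropietro2006, §2.5 (2.47) p0010:L62] -/
theorem unitNormal_levelRadius (eps : (Fin 2 → ℝ) → ℝ) (μ θ e : ℝ) :
    BGM2003.unitNormal (fun ϑ e' => levelRadius eps (μ + e') ϑ) θ e =
      polarNormal (levelRadius eps (μ + e)) θ :=
  (polarNormal_eq_unitNormal (fun ϑ e' => levelRadius eps (μ + e') ϑ) e θ).symm

/-- `1/r(θ, e)` of the family `U θ e = levelRadius ε (μ+e) θ` is `polarCurvature` of the scale-`h` curve
`Σ(e)`: the convexity clause `c ≤ polarCurvature (levelRadius ε_h (μ+e)) θ` of `BGM2006_Lemma_2_1` (1) ((2.40))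
and `c ≤ curvature U θ e` of `BGM2003.DispersionHyp.convex` ((2.8a)) are one inequality.
[cite: BenfattoGiulianiMastropietro2006, §2.4 Lemma 2.1 (2.40) p0009:L39] -/
theorem curvature_levelRadius (eps : (Fin 2 → ℝ) → ℝ) (μ θ e : ℝ) :
    BGM2003.curvature (fun ϑ e' => levelRadius eps (μ + e') ϑ) θ e =
      polarCurvature (levelRadius eps (μ + e)) θ :=
  (polarCurvature_eq_curvature (fun ϑ e' => levelRadius eps (μ + e') ϑ) e θ).symm

/-! ### The polar radius depends on `θ` only through the ray: periodicity and central symmetry -/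

/-- Two angles with the same dispersion profile along their rays have the same level radius `u_h(θ, e)` of
Lemma 2.1 (1) (the defining predicates `IsLevelRadius`, hence their Hilbert `ε`, coincide) — the device behind
every symmetry of the polar chart. [cite: BenfattoGiulianiMastropietro2006, §2.4 Lemma 2.1 (1) p0009:L44] -/
theorem levelRadius_congr {eps : (Fin 2 → ℝ) → ℝ} {lev θ θ' : ℝ}
    (h : ∀ t : ℝ, eps (t • dir θ') = eps (t • dir θ)) : levelRadius eps lev θ' = levelRadius eps lev θ := by
  have hP : IsLevelRadius eps lev θ' = IsLevelRadius eps lev θ := by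
    funext t
    simp only [IsLevelRadius, h t]
  unfold levelRadius
  rw [hP]

/-- `u(θ + 2π, e) = u(θ, e)` for EVERY dispersion (also where `levelRadius` is a junk value): "`u(θ, e)`
… periodic in `θ` with period `2π`" (BGM 2003 §1.2 item 1) — the clause `DispersionHyp.periodic_u` for the
chart `U θ e = levelRadius ε (μ + e) θ`. [cite: BenfattoGiulianiMastropietro2003, §1.2 item 1 p.4 (L97–119)] -/
theorem levelRadius_add_two_pi (eps : (Fin 2 → ℝ) → ℝ) (lev θ : ℝ) :
    levelRadius eps lev (θ + 2 * π) = levelRadius eps lev θ :=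
  levelRadius_congr fun t => by rw [dir_add_two_pi]

/-- **Central symmetry from evenness**: if `ε(-k⃗) = ε(k⃗)` then `u(θ + π, e) = u(θ, e)` ("symmetric by
reflection with respect to the origin", Lemma 2.1 (1); (A1.4) of BGM 2003) — for every level, with no
smallness hypothesis. [cite: BenfattoGiulianiMastropietro2006, §2.4 Lemma 2.1 (1) p0009:L44] -/
theorem levelRadius_add_pi_of_even {eps : (Fin 2 → ℝ) → ℝ} (heven : ∀ k, eps (-k) = eps k) (lev θ : ℝ) :
    levelRadius eps lev (θ + π) = levelRadius eps lev θ :=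
  levelRadius_congr fun t => by rw [dir_add_pi, smul_neg, heven]

/-- Under (2.36a) (`BGMSymmetry E`) the effective dispersion `ε_h` (2.36c) is even, so the scale-`h` polar
radius satisfies `u_h(θ + π, e) = u_h(θ, e)` — the reflection-symmetry clause of `BGM2006_Lemma_2_1` (1)
holds at every scale and level, unconditionally in `U`. [cite: BenfattoGiulianiMastropietro2006, §2.4 Lemma 2.1 (1) and Remark after (2.36c) p0008:L118] -/
theorem levelRadius_bgmEffDisp_add_pi {E : ℤ → ℝ × (Fin 2 → ℝ) → ℂ} (hE : BGMSymmetry E) (β : ℝ) (h : ℤ)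
    (lev θ : ℝ) :
    levelRadius (bgmEffDisp β E h) lev (θ + π) = levelRadius (bgmEffDisp β E h) lev θ :=
  levelRadius_add_pi_of_even (fun k => bgmEffDisp_neg hE β h k) lev θ

/-! ### The `h = 0` chart: `levelRadius ε μ = fermiRadius μ = bandFermiRadius μ` on BGM's window -/

/-- **The two tree charts of the free Fermi curve agree on BGM's window** `-4 < μ < -2-√2`: the
`[0, π/2]`-root `fermiRadius μ θ` (`HubbardFermiRadius`) is the band root `bandFermiRadius μ θ`
(`HubbardFermiRadiusBand`, whole lower band `-4 < μ < 0`), by uniqueness of the latter (`π/2·‖e⃗_r‖_∞ ≤ π`);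
both are BGM's `u₀(θ, 0) = |p⃗_F^{(0)}(θ)|` ("we put `u₀(θ,0)e⃗_r(θ) = p⃗_F^{(0)}(θ)`").
[cite: BenfattoGiulianiMastropietro2006, §2.4 (before Lemma 2.1) p0009:L30] -/
theorem fermiRadius_eq_bandFermiRadius {μ : ℝ} (hμ₁ : -4 < μ) (hμ₂ : μ < -2 - Real.sqrt 2) (θ : ℝ) :
    fermiRadius μ θ = bandFermiRadius μ θ := by
  have hμ0 : μ < 0 := hμ₂.trans_le (by nlinarith [Real.sqrt_nonneg 2])
  have hF := isFermiRadius_fermiRadius hμ₁ hμ₂ θ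
  refine bandFermiRadius_unique hμ₁ hμ0 ⟨⟨hF.1.1, ?_⟩, hF.2⟩
  calc fermiRadius μ θ * ‖dir θ‖ ≤ π / 2 * 1 :=
        mul_le_mul hF.1.2 (norm_dir_le_one θ) (norm_nonneg _) (by positivity)
    _ ≤ π := by linarith [Real.pi_pos]

/-- At `E_h ≡ ε` (`U = 0`) t1's chart of Lemma 2.1 is the route's chart of `klfs_bgm2003_dispersionHyp`:
`levelRadius sqDispersion (μ + e) θ = bandFermiRadius (μ + e) θ` whenever the level `μ + e` lies in BGM's
window. [cite: BenfattoGiulianiMastropietro2006, §2.4 (before Lemma 2.1) p0009:L30] -/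
theorem levelRadius_sqDispersion_eq_bandFermiRadius {μ e : ℝ} (h₁ : -4 < μ + e)
    (h₂ : μ + e < -2 - Real.sqrt 2) (θ : ℝ) :
    levelRadius sqDispersion (μ + e) θ = bandFermiRadius (μ + e) θ := by
  rw [levelRadius_sqDispersion]
  exact fermiRadius_eq_bandFermiRadius h₁ h₂ θ

end Literature.MathematicalPhysics.QuantumLattice.FermiRG
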